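import Mathlib
import Literature.Analysis.FluidPDE.Tao2016AveragedNS.ShiftSetCascadeFlows
import Literature.Analysis.FluidPDE.Tao2016AveragedNS.ShiftSetCascadeFlux
import Summits.NavierStokesRegularity.NavierStokesRegularity.Theorems.TaoLadderRungTwoFlatQuadPolarOn
import Summits.NavierStokesRegularity.NavierStokesRegularity.Theorems.TaoLadderRungTwoFlatLinearisedUniqueness
import Summits.NavierStokesRegularity.NavierStokesRegularity.Theorems.TaoLadderRungTwoFlatForcedGronwall
import Summits.NavierStokesRegularity.NavierStokesRegularity.Theorems.TaoLadderRungTwoFlatGaugeGronwall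
import Summits.NavierStokesRegularity.NavierStokesRegularity.Theorems.TaoLadderRungTwoFlatLinearisedPersistence
import Summits.NavierStokesRegularity.NavierStokesRegularity.Theorems.TaoLadderRungTwoFlatGaugeGronwallOn
import HarnessLib

/-!
# Continuity of lattice solutions IN THE TABLE on a time window (sup and gauge forms) — the inputs `δ_D`, `Δ`,
  `M_ν` of `linHop_persistence(_Icc)` for a window solution of a perturbed table
  (helper for item stmt-NavierStokesRegularity-22987 `FlatGapCertificatesV2`, crux K_A♭ of route TaoLadderRungTwoFlat;
  cell harvest/h2-tao-ladder, p1 g20 — window versions of `…ForcedGronwall.abs_sub_le_of_tables` and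
  `…LinearisedPersistence.gauge_abs_sub_le_of_tables`; with `β = renormTable ε₀ α` and
  `…RatioContinuity.tableAbsSum_renormTable_sub_le` (`‖α̃ − α‖₁ ≤ 31ε₀‖α‖₁`) they bound the distance between the
  λ₀ = 1 reference and the renormalised graded flow from the same data over one hop window)

For `X` a solution of the `α`-lattice and `Y` of the `β`-lattice on the window `[0, T]` (continuous on `Icc 0 T`,
`HasDerivAt` on `Ioo 0 T`, both bounded by `M` there), scale ratio `1`, nearest-neighbour `𝕊`:

* `gauge_abs_le_exp_self_Icc` — a window solution's own gauge bound propagates: `w|Y(s)| ≤ w|Y(0)|·e^{‖β‖₁MΛs}`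
  (`Ẏ = Q_β(Y) = Lin_{β,Y/2}(Y)`), the input `M_ν`;
* `abs_sub_le_of_tables_Icc` — sup form: `|X − Y|(s) ≤ (B_D + ‖α−β‖₁M²s)·e^{2‖α‖₁Ms}`;
* `gauge_abs_sub_le_of_tables_Icc` — gauge form: `w|X − Y|(s) ≤ (B_D + ‖α−β‖₁MΛM_w s)·e^{2‖α‖₁MΛs}` given `w|Y| ≤ M_w` on
  the window.

HONEST FRAMING: elementary perturbation theory for MODEL lattices; nothing certified; nothing about the Navier–Stokes
equations.
-/

noncomputable section

-- the sub-problem namespace repeats the summit name by design (D-0017)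
set_option linter.dupNamespace false

namespace Summit.NavierStokesRegularity.NavierStokesRegularity.Theorems

open Set Filter Literature.Analysis.FluidPDE Literature.Analysis.FluidPDE.TaoCascade
open scoped Topology Nat

namespace QuadPolar

variable {m : ℕ}

/-- `Q(Y) = Lin_{Y/2}(Y)` (Euler). [cite: Tao2016AveragedNS, §4 (4.8)] -/
theorem quadTermOn_eq_linTermOn_half (𝕊 : Finset (ℤ × ℤ × ℤ)) (ε₀ : ℝ)
    (β : Fin m → Fin m → Fin m → ℤ × ℤ × ℤ → ℝ) (Y : Fin m → ℤ → ℝ → ℝ) (i : Fin m) (n : ℤ) (t : ℝ) :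
    quadTermOn 𝕊 ε₀ β Y i n t = linTermOn 𝕊 ε₀ β ((1 / 2 : ℝ) • Y) Y i n t := by
  rw [linTermOn, bilinOn_smul_left, bilinOn_smul_right, quadTermOn_eq_bilinOn]
  ring

/-- **A window solution's gauge bound propagates**: `Ẏ = Q_β(Y)` on `Ioo 0 T`, `|Y| ≤ M` on the window, gauge `w`
window-regular (`Λ`), `w|Y(0)| ≤ B_w` ⟹ `w|Y(s)| ≤ B_w·e^{2‖β‖₁(M/2)Λ s}` on `[0, T]`.
[cite: Tao2016AveragedNS, §4 (4.8); folklore (Gronwall)] -/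
theorem gauge_abs_le_exp_self_Icc {𝕊 : Finset (ℤ × ℤ × ℤ)} (h𝕊 : IsNearestNeighbourSet 𝕊)
    (β : Fin m → Fin m → Fin m → ℤ × ℤ × ℤ → ℝ) {w : Fin m → ℤ → ℝ} {Λ : ℝ} (hw : IsWindowRegular w Λ)
    {Y : Fin m → ℤ → ℝ → ℝ} {M Bw T : ℝ} (hYc : ∀ i n, ContinuousOn (Y i n) (Icc 0 T))
    (hY : ∀ i n, ∀ t ∈ Ioo 0 T, HasDerivAt (Y i n) (quadTermOn 𝕊 0 β Y i n t) t)
    (hYb : ∀ i n, ∀ t ∈ Icc 0 T, |Y i n t| ≤ M) (hBw : ∀ i n, w i n * |Y i n 0| ≤ Bw) (i : Fin m) (n : ℤ)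
    {s : ℝ} (hs : s ∈ Icc 0 T) : w i n * |Y i n s| ≤ Bw * Real.exp (2 * tableAbsSum 𝕊 β * (M / 2) * Λ * s) := by
  set Ψ : Fin m → ℤ → ℝ → ℝ := (1 / 2 : ℝ) • Y with hΨ
  have hΨc : ∀ j k, ContinuousOn (Ψ j k) (Icc 0 T) := fun j k => by
    show ContinuousOn (fun t => (1 / 2 : ℝ) * Y j k t) (Icc 0 T); exact continuousOn_const.mul (hYc j k)
  have hΨb : ∀ j k, ∀ t ∈ Icc 0 T, |Ψ j k t| ≤ M / 2 := fun j k t ht => by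
    show |(1 / 2 : ℝ) * Y j k t| ≤ M / 2
    rw [abs_mul, abs_of_pos (by norm_num : (0 : ℝ) < 1 / 2)]
    linarith [hYb j k t ht]
  have hder : ∀ j k, ∀ t ∈ Ioo 0 T, HasDerivAt (Y j k) (linTermOn 𝕊 0 β Ψ Y j k t) t := fun j k t ht => by
    rw [hΨ, ← quadTermOn_eq_linTermOn_half]; exact hY j k t ht
  exact gauge_abs_le_exp_Icc h𝕊 β hw hΨc hΨb hYc hder hYb hBw i n hs

/-- **GAUGE CONTINUITY IN THE TABLE ON A WINDOW**: `X` solves the `α`-lattice, `Y` the `β`-lattice on `[0, T]`, both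
bounded by `M`; gauge window-regular (`Λ`); `w|Y| ≤ M_w` on the window; `w|X(0) − Y(0)| ≤ B_D`. Then
`w|X − Y|(s) ≤ (B_D + ‖α−β‖₁MΛM_w s)·e^{2‖α‖₁MΛ s}` on `[0, T]`. [cite: Tao2016AveragedNS, §4 (4.8); folklore (Duhamel–Gronwall)] -/
theorem gauge_abs_sub_le_of_tables_Icc {𝕊 : Finset (ℤ × ℤ × ℤ)} (h𝕊 : IsNearestNeighbourSet 𝕊)
    (α β : Fin m → Fin m → Fin m → ℤ × ℤ × ℤ → ℝ) {w : Fin m → ℤ → ℝ} {Λ : ℝ} (hw : IsWindowRegular w Λ)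
    {X Y : Fin m → ℤ → ℝ → ℝ} {M Mw BD T : ℝ}
    (hXc : ∀ i n, ContinuousOn (X i n) (Icc 0 T)) (hYc : ∀ i n, ContinuousOn (Y i n) (Icc 0 T))
    (hX : ∀ i n, ∀ t ∈ Ioo 0 T, HasDerivAt (X i n) (quadTermOn 𝕊 0 α X i n t) t)
    (hY : ∀ i n, ∀ t ∈ Ioo 0 T, HasDerivAt (Y i n) (quadTermOn 𝕊 0 β Y i n t) t)
    (hXb : ∀ i n, ∀ t ∈ Icc 0 T, |X i n t| ≤ M) (hYb : ∀ i n, ∀ t ∈ Icc 0 T, |Y i n t| ≤ M) (hMw : 0 ≤ Mw)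
    (hYg : ∀ i n, ∀ t ∈ Icc 0 T, w i n * |Y i n t| ≤ Mw) (hBD : ∀ i n, w i n * |X i n 0 - Y i n 0| ≤ BD)
    (i : Fin m) (n : ℤ) {s : ℝ} (hs : s ∈ Icc 0 T) :
    w i n * |X i n s - Y i n s| ≤
      (BD + tableAbsSum 𝕊 (α - β) * M * Λ * Mw * s) * Real.exp (2 * tableAbsSum 𝕊 α * M * Λ * s) := by
  set Ψ : Fin m → ℤ → ℝ → ℝ := (1 / 2 : ℝ) • (X + Y) with hΨ
  set η : Fin m → ℤ → ℝ → ℝ := X - Y with hη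
  set f : Fin m → ℤ → ℝ → ℝ := fun j k t => quadTermOn 𝕊 0 (α - β) Y j k t with hf
  have hΨc : ∀ j k, ContinuousOn (Ψ j k) (Icc 0 T) := fun j k => by
    show ContinuousOn (fun t => (1 / 2 : ℝ) * (X j k t + Y j k t)) (Icc 0 T)
    exact continuousOn_const.mul ((hXc j k).add (hYc j k))
  have hηc : ∀ j k, ContinuousOn (η j k) (Icc 0 T) := fun j k => by
    show ContinuousOn (fun t => X j k t - Y j k t) (Icc 0 T); exact (hXc j k).sub (hYc j k)
  have hΨb : ∀ j k, ∀ t ∈ Icc 0 T, |Ψ j k t| ≤ M := fun j k t ht => by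
    show |(1 / 2 : ℝ) * (X j k t + Y j k t)| ≤ M
    rw [abs_mul, abs_of_pos (by norm_num : (0 : ℝ) < 1 / 2)]
    linarith [abs_add_le (X j k t) (Y j k t), hXb j k t ht, hYb j k t ht]
  have hfc : ∀ j k, ContinuousOn (f j k) (Icc 0 T) := fun j k => continuousOn_quadTermOn 𝕊 0 (α - β) hYc j k
  have hff : ∀ j k, ∀ t ∈ Icc 0 T, w j k * |f j k t| ≤ tableAbsSum 𝕊 (α - β) * M * Λ * Mw := fun j k t ht =>
    gauge_abs_quadTermOn_le_of_sup h𝕊 (α - β) hw (fun j' k' => hYb j' k' t ht) hMw fun j' k' _ => hYg j' k' t ht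
  have hM : 0 ≤ M := (abs_nonneg _).trans (hXb i n 0 ⟨le_rfl, hs.1.trans hs.2⟩)
  have hF : 0 ≤ tableAbsSum 𝕊 (α - β) * M * Λ * Mw := by
    have := tableAbsSum_nonneg 𝕊 (α - β); have := hw.2.1; positivity
  have hder : ∀ j k, ∀ t ∈ Ioo 0 T, HasDerivAt (η j k) (linTermOn 𝕊 0 α Ψ η j k t + f j k t) t := by
    intro j k t ht
    have e : quadTermOn 𝕊 0 α X j k t - quadTermOn 𝕊 0 β Y j k t = linTermOn 𝕊 0 α Ψ η j k t + f j k t := by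
      have e1 : quadTermOn 𝕊 0 α X j k t - quadTermOn 𝕊 0 α Y j k t = linTermOn 𝕊 0 α Ψ η j k t := by
        rw [hΨ, hη]; exact quadTermOn_sub_eq_linTermOn_mid 𝕊 0 α X Y j k t
      have e2 : quadTermOn 𝕊 0 α Y j k t - quadTermOn 𝕊 0 β Y j k t = f j k t := by
        rw [hf]; exact quadTermOn_sub_table 𝕊 0 α β Y j k t
      linarith
    rw [← e]
    exact (hX j k t ht).sub (hY j k t ht)
  have hηb : ∀ j k, ∀ t ∈ Icc 0 T, |η j k t| ≤ 2 * M := fun j k t ht => by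
    show |X j k t - Y j k t| ≤ 2 * M
    linarith [abs_sub (X j k t) (Y j k t), hXb j k t ht, hYb j k t ht]
  exact gauge_abs_le_forced_exp_Icc h𝕊 α hw hΨc hΨb hfc hff hF hηc hder hηb hBD i n hs

/-- **SUP CONTINUITY IN THE TABLE ON A WINDOW** (the `w ≡ 1` instance): `|X − Y|(s) ≤ (B_D + ‖α−β‖₁M² s)·e^{2‖α‖₁M s}`.
[cite: Tao2016AveragedNS, §4 (4.8); folklore (Duhamel–Gronwall)] -/
theorem abs_sub_le_of_tables_Icc {𝕊 : Finset (ℤ × ℤ × ℤ)} (h𝕊 : IsNearestNeighbourSet 𝕊)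
    (α β : Fin m → Fin m → Fin m → ℤ × ℤ × ℤ → ℝ) {X Y : Fin m → ℤ → ℝ → ℝ} {M BD T : ℝ}
    (hXc : ∀ i n, ContinuousOn (X i n) (Icc 0 T)) (hYc : ∀ i n, ContinuousOn (Y i n) (Icc 0 T))
    (hX : ∀ i n, ∀ t ∈ Ioo 0 T, HasDerivAt (X i n) (quadTermOn 𝕊 0 α X i n t) t)
    (hY : ∀ i n, ∀ t ∈ Ioo 0 T, HasDerivAt (Y i n) (quadTermOn 𝕊 0 β Y i n t) t)
    (hXb : ∀ i n, ∀ t ∈ Icc 0 T, |X i n t| ≤ M) (hYb : ∀ i n, ∀ t ∈ Icc 0 T, |Y i n t| ≤ M)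
    (hBD : ∀ i n, |X i n 0 - Y i n 0| ≤ BD) (i : Fin m) (n : ℤ) {s : ℝ} (hs : s ∈ Icc 0 T) :
    |X i n s - Y i n s| ≤ (BD + tableAbsSum 𝕊 (α - β) * M ^ 2 * s) * Real.exp (2 * tableAbsSum 𝕊 α * M * s) := by
  have h1 : IsWindowRegular (fun (_ : Fin m) (_ : ℤ) => (1 : ℝ)) 1 :=
    ⟨fun _ _ => zero_lt_one, le_rfl, fun _ _ _ _ _ => by norm_num⟩
  have hM : 0 ≤ M := (abs_nonneg _).trans (hXb i n 0 ⟨le_rfl, hs.1.trans hs.2⟩)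
  have hYg : ∀ i n, ∀ t ∈ Icc 0 T, (1 : ℝ) * |Y i n t| ≤ M := fun i n t ht => by rw [one_mul]; exact hYb i n t ht
  have h := gauge_abs_sub_le_of_tables_Icc h𝕊 α β h1 hXc hYc hX hY hXb hYb hM hYg
    (fun i n => by rw [one_mul]; exact hBD i n) i n hs
  rw [one_mul] at h
  have e1 : tableAbsSum 𝕊 (α - β) * M * 1 * M * s = tableAbsSum 𝕊 (α - β) * M ^ 2 * s := by ring
  have e2 : 2 * tableAbsSum 𝕊 α * M * 1 * s = 2 * tableAbsSum 𝕊 α * M * s := by ring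
  rw [e1, e2] at h
  exact h

end QuadPolar

end Summit.NavierStokesRegularity.NavierStokesRegularity.Theorems

end
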